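import Summits.HubbardSuperconductivity.HubbardSuperconductivity.Theorems.AnisotropyChordStiffnessKLipschitz

/-!
# Route `AnisotropyChord` / H0 rotor rung: the FIRST MOMENT against the DOUBLE COMMUTATOR (stub K1 ⟸ K1′) and
# KERNEL REALITY (stub K3) — theory seat memo ROTOR-THEORY-8 §120, Sketch8 Part Q + section KernelReality ported

PROVED: `sum_eigenvalues_mul_norm_sq`, `sum_excitation_mul_norm_sq` (spectral first moment), `doubleComm_expect_eq`,
`firstMoment_le_doubleComm`, `minEnergyOn_mul_le_rayleigh`, **`firstMomentLocality_of_doubleComm`**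
(`DoubleCommutatorBound → FirstMomentLocality`), `filteredKernel_conj_symm`, `norm_filteredKernel_eq_half_of_symm`.
TYPED: K1′ `DoubleCommutatorBound` (support counting; work-order W5), K3 `FilteredKernelSymmetric` (time reversal; W6).
Typing authority: theory seat `hubbard-h0-rotor-theory-1`, cycle 8.
-/

set_option linter.dupNamespace false

noncomputable section

open Matrix Complex Finset Filter Topology MeasureTheory
open scoped ComplexConjugate
open Literature.MathematicalPhysics.QuantumLattice hiding torusPhase torusNorm
open Literature.Probability.LatticeModels
open Summit.HubbardSuperconductivity.HubbardSuperconductivity.Theorems.AnisotropyChord.InsertionEntropy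

namespace Summit.HubbardSuperconductivity.HubbardSuperconductivity.Theorems.AnisotropyChord.Stiffness

/-! ## Part Q — the first moment against the double commutator -/

section FirstMoment

variable {m : Type*} [Fintype m] [DecidableEq m]

/-- Spectral first moment: `Σᵢ λᵢ |⟨vᵢ,w⟩|² = ⟨w, Hw⟩`. [folklore] -/
theorem sum_eigenvalues_mul_norm_sq {H : Matrix m m ℂ} (hH : H.IsHermitian) (w : m → ℂ) :
    ((∑ i, hH.eigenvalues i * ‖star (⇑(hH.eigenvectorBasis i)) ⬝ᵥ w‖ ^ 2 : ℝ) : ℂ)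
      = star w ⬝ᵥ (H *ᵥ w) := by
  have hw := sum_dotProduct_smul_eigenvectorBasis hH w
  have hHw : H *ᵥ w = ∑ i, (star (⇑(hH.eigenvectorBasis i)) ⬝ᵥ w) •
      ((hH.eigenvalues i : ℂ) • ⇑(hH.eigenvectorBasis i)) := by
    conv_lhs => rw [← hw]
    rw [Matrix.mulVec_sum]
    refine Finset.sum_congr rfl fun i _ => ?_
    rw [Matrix.mulVec_smul, hH.mulVec_eigenvectorBasis]
    congr 1
  rw [hHw, dotProduct_sum]
  push_cast
  refine Finset.sum_congr rfl fun i _ => ?_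
  rw [dotProduct_smul, dotProduct_smul, smul_eq_mul, smul_eq_mul,
    Matrix.star_dotProduct w ⇑(hH.eigenvectorBasis i), ← Complex.conj_mul']
  simp only [Complex.star_def]
  ring

/-- `Σᵢ (λᵢ − E)|⟨vᵢ,w⟩|² = ⟨w,Hw⟩ − E Σᵢ|⟨vᵢ,w⟩|²` (`= ⟨w,Hw⟩ − E‖w‖²` by Parseval). [folklore] -/
theorem sum_excitation_mul_norm_sq {H : Matrix m m ℂ} (hH : H.IsHermitian) (E : ℝ) (w : m → ℂ) :
    ((∑ i, (hH.eigenvalues i - E) * ‖star (⇑(hH.eigenvectorBasis i)) ⬝ᵥ w‖ ^ 2 : ℝ) : ℂ)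
      = star w ⬝ᵥ (H *ᵥ w) - (E : ℂ) * ((‖WithLp.toLp 2 w‖ ^ 2 : ℝ) : ℂ) := by
  simp_rw [sub_mul]
  rw [Finset.sum_sub_distrib, ← Finset.mul_sum, sum_norm_sq_dotProduct_eigenvectorBasis hH w,
    Complex.ofReal_sub, sum_eigenvalues_mul_norm_sq hH w, Complex.ofReal_mul]

omit [DecidableEq m] in
/-- **DOUBLE-COMMUTATOR IDENTITY.** For `Hψ = Eψ` (`H` Hermitian, `E` real) and any `W`:
`⟨ψ,(WᴴHW − WᴴWH − HWWᴴ + WHWᴴ)ψ⟩ = (⟨Wψ,HWψ⟩ − E⟨Wψ,Wψ⟩) + (⟨Wᴴψ,HWᴴψ⟩ − E⟨Wᴴψ,Wᴴψ⟩)`. [folklore] -/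
theorem doubleComm_expect_eq {H : Matrix m m ℂ} (hH : H.IsHermitian) (E : ℝ) (ψ : m → ℂ)
    (hψ : H *ᵥ ψ = (E : ℂ) • ψ) (W : Matrix m m ℂ) :
    star ψ ⬝ᵥ ((Wᴴ * (H * W) - Wᴴ * (W * H) - H * (W * Wᴴ) + W * (H * Wᴴ)) *ᵥ ψ)
      = (star (W *ᵥ ψ) ⬝ᵥ (H *ᵥ (W *ᵥ ψ)) - (E : ℂ) * (star (W *ᵥ ψ) ⬝ᵥ (W *ᵥ ψ)))
        + (star (Wᴴ *ᵥ ψ) ⬝ᵥ (H *ᵥ (Wᴴ *ᵥ ψ)) - (E : ℂ) * (star (Wᴴ *ᵥ ψ) ⬝ᵥ (Wᴴ *ᵥ ψ))) := by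
  -- `⟨ψ| H = E ⟨ψ|`
  have hψH : star ψ ᵥ* H = (E : ℂ) • star ψ := by
    have h1 : star ψ ᵥ* H = star (H *ᵥ ψ) := by
      rw [Matrix.star_mulVec, hH.eq]
    rw [h1, hψ, star_smul, Complex.star_def, Complex.conj_ofReal]
  have hW : star ψ ᵥ* Wᴴ = star (W *ᵥ ψ) := by rw [Matrix.star_mulVec]
  have hW' : star ψ ᵥ* W = star (Wᴴ *ᵥ ψ) := by
    rw [Matrix.star_mulVec, conjTranspose_conjTranspose]
  simp only [Matrix.sub_mulVec, Matrix.add_mulVec, dotProduct_sub, dotProduct_add, ← Matrix.mulVec_mulVec]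
  -- term by term
  have t1 : star ψ ⬝ᵥ (Wᴴ *ᵥ (H *ᵥ (W *ᵥ ψ))) = star (W *ᵥ ψ) ⬝ᵥ (H *ᵥ (W *ᵥ ψ)) := by
    rw [Matrix.dotProduct_mulVec, hW]
  have t2 : star ψ ⬝ᵥ (Wᴴ *ᵥ (W *ᵥ (H *ᵥ ψ))) = (E : ℂ) * (star (W *ᵥ ψ) ⬝ᵥ (W *ᵥ ψ)) := by
    rw [hψ, Matrix.mulVec_smul, Matrix.mulVec_smul, dotProduct_smul, smul_eq_mul,
      Matrix.dotProduct_mulVec, hW]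
  have t3 : star ψ ⬝ᵥ (H *ᵥ (W *ᵥ (Wᴴ *ᵥ ψ))) = (E : ℂ) * (star (Wᴴ *ᵥ ψ) ⬝ᵥ (Wᴴ *ᵥ ψ)) := by
    rw [Matrix.dotProduct_mulVec, hψH, smul_dotProduct, smul_eq_mul, Matrix.dotProduct_mulVec, hW']
  have t4 : star ψ ⬝ᵥ (W *ᵥ (H *ᵥ (Wᴴ *ᵥ ψ))) = star (Wᴴ *ᵥ ψ) ⬝ᵥ (H *ᵥ (Wᴴ *ᵥ ψ)) := by
    rw [Matrix.dotProduct_mulVec, hW']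
  rw [t1, t2, t3, t4]
  ring

omit [DecidableEq m] in
/-- **FIRST MOMENT ≤ DOUBLE COMMUTATOR.** If in addition `⟨Wᴴψ,(H−E)Wᴴψ⟩ ≥ 0` then
`Re(⟨Wψ,HWψ⟩ − E⟨Wψ,Wψ⟩) ≤ Re⟨ψ,[Wᴴ,[H,W]]ψ⟩`. [folklore] -/
theorem firstMoment_le_doubleComm {H : Matrix m m ℂ} (hH : H.IsHermitian) (E : ℝ) (ψ : m → ℂ)
    (hψ : H *ᵥ ψ = (E : ℂ) • ψ) (W : Matrix m m ℂ)
    (hpos : 0 ≤ (star (Wᴴ *ᵥ ψ) ⬝ᵥ (H *ᵥ (Wᴴ *ᵥ ψ))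
      - (E : ℂ) * (star (Wᴴ *ᵥ ψ) ⬝ᵥ (Wᴴ *ᵥ ψ))).re) :
    (star (W *ᵥ ψ) ⬝ᵥ (H *ᵥ (W *ᵥ ψ)) - (E : ℂ) * (star (W *ᵥ ψ) ⬝ᵥ (W *ᵥ ψ))).re
      ≤ (star ψ ⬝ᵥ ((Wᴴ * (H * W) - Wᴴ * (W * H) - H * (W * Wᴴ) + W * (H * Wᴴ)) *ᵥ ψ)).re := by
  rw [doubleComm_expect_eq hH E ψ hψ W, Complex.add_re]
  linarith

omit [DecidableEq m] in
/-- `⟨u,u⟩ = ‖u‖²` in `dotProduct` currency. [folklore] -/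
theorem star_dotProduct_self_eq_norm_sq (u : m → ℂ) :
    star u ⬝ᵥ u = ((‖WithLp.toLp 2 u‖ ^ 2 : ℝ) : ℂ) := by
  rw [EuclideanSpace.norm_sq_eq]
  push_cast
  simp only [dotProduct, Pi.star_apply, Complex.star_def, Complex.conj_mul']

/-- The sector energy bounds the (un-normalised) Rayleigh quotient on the sector:
`minEnergyOn H K · ‖u‖² ≤ Re⟨u,Hu⟩` for `u ∈ K`. [folklore] -/
theorem minEnergyOn_mul_le_rayleigh {H : Matrix m m ℂ} (hH : H.IsHermitian) (K : Submodule ℂ (m → ℂ))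
    {u : m → ℂ} (hu : u ∈ K) :
    H.minEnergyOn K * ‖WithLp.toLp 2 u‖ ^ 2 ≤ (star u ⬝ᵥ H *ᵥ u).re := by
  by_cases h0 : u = 0
  · subst h0
    simp
  have hc : 0 < ‖WithLp.toLp 2 u‖ := by
    rw [norm_pos_iff]
    intro h
    exact h0 (by simpa using congrArg WithLp.ofLp h)
  set c : ℝ := ‖WithLp.toLp 2 u‖ with hcdef
  have hcne : (c : ℂ) ≠ 0 := by exact_mod_cast hc.ne'
  let ψ : m → ℂ := ((c : ℂ)⁻¹) • u
  have hψK : ψ ∈ K := K.smul_mem _ hu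
  have huu : star u ⬝ᵥ u = ((c ^ 2 : ℝ) : ℂ) := star_dotProduct_self_eq_norm_sq u
  have h1 : star ψ ⬝ᵥ ψ = 1 := by
    show star (((c : ℂ)⁻¹) • u) ⬝ᵥ (((c : ℂ)⁻¹) • u) = 1
    rw [star_smul, smul_dotProduct, dotProduct_smul, huu, Complex.star_def, map_inv₀,
      Complex.conj_ofReal, smul_eq_mul, smul_eq_mul]
    push_cast
    field_simp
  have h2 := minEnergyOn_le_rayleigh_of_mem hH K hψK h1
  have h3 : star ψ ⬝ᵥ H *ᵥ ψ = ((c ^ 2)⁻¹ : ℝ) * (star u ⬝ᵥ H *ᵥ u) := by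
    show star (((c : ℂ)⁻¹) • u) ⬝ᵥ H *ᵥ (((c : ℂ)⁻¹) • u) = _
    rw [star_smul, smul_dotProduct, Matrix.mulVec_smul, dotProduct_smul, Complex.star_def, map_inv₀,
      Complex.conj_ofReal, smul_eq_mul, smul_eq_mul]
    push_cast
    ring
  rw [h3, Complex.re_ofReal_mul] at h2
  have hc2 : 0 < c ^ 2 := by positivity
  calc H.minEnergyOn K * c ^ 2 ≤ (c ^ 2)⁻¹ * (star u ⬝ᵥ H *ᵥ u).re * c ^ 2 :=
        mul_le_mul_of_nonneg_right h2 hc2.le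
    _ = (star u ⬝ᵥ H *ᵥ u).re := by field_simp

omit [DecidableEq m] in
/-- Positivity of the dropped bracket from an invariant subspace: if `u ∈ K`, `H K ⊆ K`... in the simplest
usable form: `H ≥ E` on `K ∋ u` in Rayleigh form gives `Re(⟨u,Hu⟩ − E⟨u,u⟩) ≥ 0`. (Here from the tree's
`minEnergyOn_le_rayleigh_of_mem` one gets it for `E = minEnergyOn H K`; stated as the hypothesis shape used above.) -/
theorem re_rayleigh_sub_nonneg_of_le {H : Matrix m m ℂ} (E : ℝ) (u : m → ℂ)
    (h : E * (‖WithLp.toLp 2 u‖ ^ 2) ≤ (star u ⬝ᵥ (H *ᵥ u)).re) :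
    0 ≤ (star u ⬝ᵥ (H *ᵥ u) - (E : ℂ) * (star u ⬝ᵥ u)).re := by
  rw [star_dotProduct_self_eq_norm_sq u, Complex.sub_re, ← Complex.ofReal_mul, Complex.ofReal_re]
  linarith


end FirstMoment

/-- The current combination `W_k(ε) := Σⱼ εⱼ Jʲ_k`. -/
def currentComb (L : ℕ) [NeZero L] (k : TorusSite 2 L) (ε : Fin 2 → ℂ) : Op (TorusSite 2 L) 2 :=
  ∑ j, ε j • currentMode L k j

/-- **STUB K1′ — DOUBLE-COMMUTATOR BOUND (pure support counting; memo §120).**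
`Re⟨ψ,[Wᴴ,[H,W]]ψ⟩ ≤ C_J L²|ε|²` for `W = W_k(ε)`: `[Wᴴ,[H,W]] = Σ_{b,b'} c̄_{b'}c_b [j_{b'}ᴴ,[H,j_b]]` and the
bracket vanishes unless `b'` is within distance 2 of `b` (`O(L²)` pairs of norm `O(1)`). -/
def DoubleCommutatorBound (Δ : ℝ) (M : ℕ → ℝ) : Prop :=
  ∃ CJ : ℝ, 0 < CJ ∧ ∀ᶠ L : ℕ in atTop, ∀ [NeZero L],
    ∀ a : (TorusSite 2 L → Fin 2) → ℝ, IsPerronSectorGroundAmplitude L Δ (M L - 1) a →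
    ∀ (k : TorusSite 2 L) (ε : Fin 2 → ℂ),
      (star (toC L a) ⬝ᵥ (((currentComb L k ε)ᴴ * (hcbHamiltonian L Δ * currentComb L k ε)
          - (currentComb L k ε)ᴴ * (currentComb L k ε * hcbHamiltonian L Δ)
          - hcbHamiltonian L Δ * (currentComb L k ε * (currentComb L k ε)ᴴ)
          + currentComb L k ε * (hcbHamiltonian L Δ * (currentComb L k ε)ᴴ)) *ᵥ toC L a)).re
        ≤ CJ * (L : ℝ) ^ 2 * ∑ j, ‖ε j‖ ^ 2

/-- **K1 ⟸ K1′ (PROVED):** the first-moment locality follows from the double-commutator bound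
(spectral first moment = `Re(⟨Wψ,HWψ⟩ − E₀‖Wψ‖²)`; the dropped bracket is `≥ 0` because `Wᴴψ ∈ sector`
and `H ≥ E₀` there). -/
theorem firstMomentLocality_of_doubleComm (Δ : ℝ) (M : ℕ → ℝ) (h : DoubleCommutatorBound Δ M) :
    FirstMomentLocality Δ M := by
  obtain ⟨CJ, hCJ, hev⟩ := h
  refine ⟨CJ, hCJ, ?_⟩
  filter_upwards [hev] with L hL
  intro _ a ha k ε
  have hH := hcbHamiltonian_isHermitian L Δ
  have hψ : hcbHamiltonian L Δ *ᵥ toC L a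
      = ((lowestEnergyInSector 1 (hcbHamiltonian L Δ) (M L - 1) : ℝ) : ℂ) • toC L a := ha.eigen
  have hWψ : currentComb L k ε *ᵥ toC L a = ∑ j, ε j • (currentMode L k j *ᵥ toC L a) := by
    unfold currentComb
    rw [sum_smul_mulVec]
  have hamp : ∀ i, ∑ j, ε j * currentAmp L Δ a k j i
      = star (⇑(hH.eigenvectorBasis i)) ⬝ᵥ (currentComb L k ε *ᵥ toC L a) := by
    intro i
    rw [sum_currentAmp_eq, hWψ]
  -- (1) the spectral first moment in Rayleigh form
  have h1 : ∑ i, excitation L Δ (M L - 1) i * ‖∑ j, ε j * currentAmp L Δ a k j i‖ ^ 2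
      = (star (currentComb L k ε *ᵥ toC L a) ⬝ᵥ
            (hcbHamiltonian L Δ *ᵥ (currentComb L k ε *ᵥ toC L a))
          - ((lowestEnergyInSector 1 (hcbHamiltonian L Δ) (M L - 1) : ℝ) : ℂ) *
            (star (currentComb L k ε *ᵥ toC L a) ⬝ᵥ (currentComb L k ε *ᵥ toC L a))).re := by
    simp_rw [hamp]
    unfold excitation
    have h := congrArg Complex.re (sum_excitation_mul_norm_sq hH
      (lowestEnergyInSector 1 (hcbHamiltonian L Δ) (M L - 1)) (currentComb L k ε *ᵥ toC L a))
    rw [Complex.ofReal_re] at h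
    rw [h, star_dotProduct_self_eq_norm_sq]
  -- (2) the dropped bracket is nonnegative
  have hmem : (currentComb L k ε)ᴴ *ᵥ toC L a ∈ spinZSector (Λ := TorusSite 2 L) 1 (M L - 1) := by
    have hW' : Commute (currentComb L k ε) (totalSpin (Λ := TorusSite 2 L) 1 2) := by
      unfold currentComb
      exact Commute.sum_left _ _ _ fun j _ => Commute.smul_left (currentMode_commute_totalSpin L k j) _
    have hc : Commute (currentComb L k ε)ᴴ (totalSpin (Λ := TorusSite 2 L) 1 2) := by
      have h' := congrArg Matrix.conjTranspose hW'.eq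
      rw [Matrix.conjTranspose_mul, Matrix.conjTranspose_mul,
        (totalSpin_isHermitian (Λ := TorusSite 2 L) 1 2).eq] at h'
      exact h'.symm
    have hs := ha.sector
    unfold spinZSector at hs ⊢
    exact mulVec_mem_eigenspace_of_commute hc hs
  have hpos : 0 ≤ (star ((currentComb L k ε)ᴴ *ᵥ toC L a) ⬝ᵥ
        (hcbHamiltonian L Δ *ᵥ ((currentComb L k ε)ᴴ *ᵥ toC L a))
      - ((lowestEnergyInSector 1 (hcbHamiltonian L Δ) (M L - 1) : ℝ) : ℂ) *
        (star ((currentComb L k ε)ᴴ *ᵥ toC L a) ⬝ᵥ ((currentComb L k ε)ᴴ *ᵥ toC L a))).re := by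
    refine re_rayleigh_sub_nonneg_of_le _ _ ?_
    unfold lowestEnergyInSector
    exact minEnergyOn_mul_le_rayleigh hH _ hmem
  -- (3) combine
  rw [h1]
  exact (firstMoment_le_doubleComm hH _ (toC L a) hψ (currentComb L k ε) hpos).trans (hL a ha k ε)


/-! ## Kernel reality (stub K3) -/

/-- Hermitian symmetry of the filtered kernel (PROVED): `conj F_{(x,j),(y,j')} = F_{(y,j'),(x,j)}`. -/
theorem filteredKernel_conj_symm (L : ℕ) [NeZero L] (Δ M : ℝ) (a : (TorusSite 2 L → Fin 2) → ℝ)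
    (Ω : ℝ) (x : TorusSite 2 L) (j : Fin 2) (y : TorusSite 2 L) (j' : Fin 2) :
    starRingEnd ℂ (filteredKernel L Δ M a Ω x j y j') = filteredKernel L Δ M a Ω y j' x j := by
  unfold filteredKernel
  rw [map_sum]
  refine Finset.sum_congr rfl fun i _ => ?_
  rw [map_mul, map_mul, Complex.conj_ofReal, Complex.conj_conj]
  ring

/-- **STUB K3 — REALITY / TIME REVERSAL of the filtered kernel:** `F_{bb'} = F_{b'b}` (equivalently `F_{bb'} ∈ ℝ`),
because `H(Δ)`, `ψ` and the `j_b` are real in the configuration basis and `Σᵢ g(ωᵢ)|vᵢ⟩⟨vᵢ| = g(H−E₀)` is then a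
real matrix (polynomial interpolation of `g` on the spectrum). Size S/M. -/
def FilteredKernelSymmetric (Δ : ℝ) (M : ℕ → ℝ) : Prop :=
  ∀ (L : ℕ) [NeZero L] (a : (TorusSite 2 L → Fin 2) → ℝ), IsPerronSectorGroundAmplitude L Δ (M L - 1) a →
    ∀ (Ω : ℝ) (x : TorusSite 2 L) (j : Fin 2) (y : TorusSite 2 L) (j' : Fin 2),
      filteredKernel L Δ (M L - 1) a Ω x j y j' = filteredKernel L Δ (M L - 1) a Ω y j' x j

/-- With K3, the symmetrised bound of K2 is a bound on the kernel itself (PROVED):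
`‖F_{bb'}‖ = ½‖F_{bb'} + F_{b'b}‖`. -/
theorem norm_filteredKernel_eq_half_of_symm (L : ℕ) [NeZero L] (Δ M : ℝ)
    (a : (TorusSite 2 L → Fin 2) → ℝ) (Ω : ℝ) (x : TorusSite 2 L) (j : Fin 2) (y : TorusSite 2 L) (j' : Fin 2)
    (hsymm : filteredKernel L Δ M a Ω x j y j' = filteredKernel L Δ M a Ω y j' x j) :
    ‖filteredKernel L Δ M a Ω x j y j'‖
      = 1 / 2 * ‖filteredKernel L Δ M a Ω x j y j' + filteredKernel L Δ M a Ω y j' x j‖ := by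
  rw [← hsymm, ← two_mul, norm_mul, Complex.norm_two]
  ring


end Summit.HubbardSuperconductivity.HubbardSuperconductivity.Theorems.AnisotropyChord.Stiffness
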